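import Summits.CriticalPhenomena.Ising3DConformalLimit.Theses.EnergyNotSigmaSquared
import Literature.Probability.LatticeModels.CriticalScalingDimension
import Literature.Probability.LatticeModels.PointwiseScalingLimitTwoPointMono

/-!
# `MoebiusLimit` (item stmt-CriticalPhenomena-1344): dilation covariance is AUTOMATIC

Negative/structural knowledge about the crux `…Theses.EnergyNotSigmaSquared.MoebiusLimit`
(= `PerfectScreening.MoebiusLimitExists`), standing crux disprover (D-0016); THEOREM-ONLY.

For ANY pointwise scaling limit `S` of the critical correlators on `ℤ³` (`ρ > 0` on `(0,1]`) with
non-degenerate two-point function — no symmetry assumed —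
* `tendsto_rho_ratio`: `ρ(cδ)/ρ(δ) → Φ(c) := (S₂(0,e₀)/S₂(0,c⁻¹e₀))^{1/2}` for every `c > 0`
  (the lattice approximations of `c·x` at mesh `cδ` and of `x` at mesh `δ` coincide);
* `smul_eq_ratio_pow_mul`: `S_n(c·x) = Φ(c)^n S_n(x)` on non-coincident `x`;
* `ratio_mul`, `ratio_le_one_of_one_lt`: `Φ` is multiplicative and `≤ 1` on `(1,∞)` (Messager–
  Miracle-Solé in the limit, tree `two_le_two_of_mul_norm_lt`, plus multiplicativity);
* `exists_ratio_eq_rpow`: hence `Φ(c) = c^{-Δ'}` for some `Δ' ≥ 0` (a monotone solution of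
  Cauchy's equation is linear: `Antitone.measurable`, `AddMonoidHom.continuous_of_measurable`,
  `map_real_smul`), and
* `exists_scaleCovariant_on_nonCoincident`: `S_n(c·x) = c^{-nΔ'} S_n(x)` on `NonCoincident`.
So the clause `IsScaleCovariant Δ S` of the crux carries no independent content beyond the value
of `Δ`: Kadanoff's scale-covariance postulate is a consequence of existence + non-degeneracy.
-/

noncomputable section

namespace Summit.CriticalPhenomena.Ising3DConformalLimit.MoebiusLimitExistsNegative

open Literature.Probability.LatticeModels Filter Set
open scoped Topology

variable {ρ : ℝ → ℝ} {S : CorrFamily 3}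

/-! ### Exactness of lattice approximations under simultaneous dilation -/

/-- `[c·p / (cδ)] = [p/δ]` for `c > 0`. [folklore] -/
theorem latticeApprox_smul_smul {c : ℝ} (hc : 0 < c) (δ : ℝ) (p : EuclideanSpace ℝ (Fin 3)) :
    latticeApprox (c * δ) (c • p) = latticeApprox δ p := by
  funext i
  rw [latticeApprox_apply, latticeApprox_apply, PiLp.smul_apply, smul_eq_mul,
    mul_div_mul_left _ _ hc.ne']

/-- The rescaled correlator of `c·x` at mesh `cδ` is `ρ(cδ)^n ⟨∏ σ_{[xᵢ/δ]}⟩`. [folklore] -/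
theorem rescaledCorrelator_smul_smul {c : ℝ} (hc : 0 < c) (n : ℕ) (δ : ℝ)
    (x : Fin n → EuclideanSpace ℝ (Fin 3)) :
    rescaledCorrelator (criticalCorr 3) ρ n (c * δ) (fun i => c • x i) =
      ρ (c * δ) ^ n * criticalCorr 3 n (fun i => latticeApprox δ (x i)) := by
  rw [rescaledCorrelator_apply]
  congr 2
  funext i
  exact latticeApprox_smul_smul hc δ (x i)

/-- `δ ↦ cδ` maps `0⁺` to `0⁺` for `c > 0`. [folklore] -/
theorem tendsto_const_mul_nhdsGT {c : ℝ} (hc : 0 < c) :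
    Tendsto (fun δ : ℝ => c * δ) (𝓝[>] (0:ℝ)) (𝓝[>] 0) := by
  refine tendsto_nhdsWithin_iff.2 ⟨?_, ?_⟩
  · have : Tendsto (fun δ : ℝ => c * δ) (𝓝 0) (𝓝 (c * 0)) := tendsto_const_nhds.mul tendsto_id
    rw [mul_zero] at this
    exact this.mono_left nhdsWithin_le_nhds
  · filter_upwards [self_mem_nhdsWithin] with δ hδ using mul_pos hc hδ

/-- Dilating a configuration by `c ≠ 0` preserves non-coincidence. [folklore] -/
theorem smul_mem_nonCoincident_iff {n : ℕ} {c : ℝ} (hc : c ≠ 0)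
    (x : Fin n → EuclideanSpace ℝ (Fin 3)) :
    (fun i => c • x i) ∈ NonCoincident 3 n ↔ x ∈ NonCoincident 3 n := by
  rw [mem_nonCoincident, mem_nonCoincident]
  exact (smul_right_injective _ hc).of_comp_iff x

/-- The axis configuration `(0, t e₀)`, `t ≠ 0`, is non-coincident. [folklore] -/
theorem axis_mem_nonCoincident {t : ℝ} (ht : t ≠ 0) :
    (![0, t • EuclideanSpace.single 0 1] : Fin 2 → EuclideanSpace ℝ (Fin 3)) ∈ NonCoincident 3 2 := by
  have h : t • (EuclideanSpace.single 0 1 : EuclideanSpace ℝ (Fin 3)) = EuclideanSpace.single 0 t := by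
    ext j
    by_cases hj : j = 0
    · subst hj; simp
    · simp [hj]
  rw [h]
  exact zero_unitVec_mem_nonCoincident ht

/-- For `δ ∈ (0, min 1 c⁻¹]`... : eventually (as `δ → 0⁺`) both `ρ(δ) > 0` and `ρ(cδ) > 0`.
[folklore] -/
theorem eventually_rho_pos_and (hρ : ∀ δ ∈ Set.Ioc (0:ℝ) 1, 0 < ρ δ) {c : ℝ} (hc : 0 < c) :
    ∀ᶠ δ in 𝓝[>] (0:ℝ), 0 < ρ δ ∧ 0 < ρ (c * δ) := by
  have h1 : ∀ᶠ δ in 𝓝[>] (0:ℝ), 0 < ρ δ := by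
    filter_upwards [Ioc_mem_nhdsGT one_pos] with δ hδ using hρ δ hδ
  have h2 : ∀ᶠ δ in 𝓝[>] (0:ℝ), 0 < ρ (c * δ) :=
    (tendsto_const_mul_nhdsGT hc).eventually h1
  exact h1.and h2

/-! ### The limiting ratio `Φ(c) = lim ρ(cδ)/ρ(δ)` -/

/-- **The renormalisation ratio converges**: for every `c > 0`,
`ρ(cδ)/ρ(δ) → Φ(c) = (S₂(0,e₀) / S₂(0, c⁻¹e₀))^{1/2}` as `δ → 0⁺`. Only the existence of the
non-degenerate pointwise limit is used. [folklore] -/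
theorem tendsto_rho_ratio (hρ : ∀ δ ∈ Set.Ioc (0:ℝ) 1, 0 < ρ δ)
    (hlim : HasPointwiseScalingLimit (criticalCorr 3) ρ S) (hnd : IsNondegenerateTwoPoint S)
    {c : ℝ} (hc : 0 < c) :
    Tendsto (fun δ => ρ (c * δ) / ρ δ) (𝓝[>] (0:ℝ))
      (𝓝 (Real.sqrt (S 2 ![0, EuclideanSpace.single 0 1] /
        S 2 ![0, c⁻¹ • EuclideanSpace.single 0 1]))) := by
  set e : EuclideanSpace ℝ (Fin 3) := EuclideanSpace.single 0 1 with he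
  set z₀ : Fin 2 → EuclideanSpace ℝ (Fin 3) := ![0, e] with hz₀
  set zc : Fin 2 → EuclideanSpace ℝ (Fin 3) := ![0, c⁻¹ • e] with hzc
  have hz₀m : z₀ ∈ NonCoincident 3 2 := by
    have := axis_mem_nonCoincident (t := 1) one_ne_zero
    simpa [hz₀] using this
  have hzcm : zc ∈ NonCoincident 3 2 := axis_mem_nonCoincident (inv_ne_zero hc.ne')
  have hA : 0 < S 2 z₀ := hnd _ hz₀m
  have hB : 0 < S 2 zc := hnd _ hzcm
  have hsmul : (fun i => c • zc i) = z₀ := by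
    funext i; fin_cases i
    · simp [hzc, hz₀]
    · simp [hzc, hz₀, smul_smul, mul_inv_cancel₀ hc.ne']
  -- numerator and denominator
  have hu : Tendsto (fun δ => rescaledCorrelator (criticalCorr 3) ρ 2 δ zc) (𝓝[>] 0) (𝓝 (S 2 zc)) :=
    (hlim 2).tendsto_at hzcm
  have hv : Tendsto (fun δ => rescaledCorrelator (criticalCorr 3) ρ 2 (c * δ) z₀) (𝓝[>] 0)
      (𝓝 (S 2 z₀)) :=
    ((hlim 2).tendsto_at hz₀m).comp (tendsto_const_mul_nhdsGT hc)
  have hratio2 : Tendsto (fun δ => (ρ (c * δ) / ρ δ) ^ 2) (𝓝[>] (0:ℝ)) (𝓝 (S 2 z₀ / S 2 zc)) := by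
    refine (hv.div hu hB.ne').congr' ?_
    filter_upwards [hu.eventually_const_lt (half_lt_self hB), eventually_rho_pos_and hρ hc] with δ hδ hρδ
    have hu0 : rescaledCorrelator (criticalCorr 3) ρ 2 δ zc ≠ 0 := by
      intro h0; rw [h0] at hδ; linarith
    have hG : criticalCorr 3 2 (fun i => latticeApprox δ (zc i)) ≠ 0 := by
      intro h0
      apply hu0
      rw [rescaledCorrelator_apply, h0, mul_zero]
    rw [Pi.div_apply, ← hsmul, rescaledCorrelator_smul_smul hc, rescaledCorrelator_apply,
      mul_div_mul_right _ _ hG, div_pow]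
  have hsq := hratio2.sqrt
  refine hsq.congr' ?_
  filter_upwards [eventually_rho_pos_and hρ hc] with δ hδ
  exact Real.sqrt_sq (div_pos hδ.2 hδ.1).le

/-- **Dilations act on any non-degenerate pointwise limit through the ratio**:
`S_n(c·x) = Φ(c)^n S_n(x)` for `c > 0` and non-coincident `x`. [folklore] -/
theorem smul_eq_ratio_pow_mul (hρ : ∀ δ ∈ Set.Ioc (0:ℝ) 1, 0 < ρ δ)
    (hlim : HasPointwiseScalingLimit (criticalCorr 3) ρ S) (hnd : IsNondegenerateTwoPoint S)
    {c : ℝ} (hc : 0 < c) {n : ℕ} {x : Fin n → EuclideanSpace ℝ (Fin 3)}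
    (hx : x ∈ NonCoincident 3 n) :
    S n (fun i => c • x i) =
      Real.sqrt (S 2 ![0, EuclideanSpace.single 0 1] /
        S 2 ![0, c⁻¹ • EuclideanSpace.single 0 1]) ^ n * S n x := by
  have hcx : (fun i => c • x i) ∈ NonCoincident 3 n := (smul_mem_nonCoincident_iff hc.ne' x).2 hx
  -- the rescaled correlator of `c·x` at mesh `cδ`, two ways
  have h1 : Tendsto (fun δ => rescaledCorrelator (criticalCorr 3) ρ n (c * δ) (fun i => c • x i))
      (𝓝[>] 0) (𝓝 (S n (fun i => c • x i))) :=
    ((hlim n).tendsto_at hcx).comp (tendsto_const_mul_nhdsGT hc)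
  have h2 : Tendsto (fun δ => (ρ (c * δ) / ρ δ) ^ n * rescaledCorrelator (criticalCorr 3) ρ n δ x)
      (𝓝[>] 0) (𝓝 (Real.sqrt (S 2 ![0, EuclideanSpace.single 0 1] /
        S 2 ![0, c⁻¹ • EuclideanSpace.single 0 1]) ^ n * S n x)) :=
    ((tendsto_rho_ratio hρ hlim hnd hc).pow n).mul ((hlim n).tendsto_at hx)
  refine tendsto_nhds_unique h1 (h2.congr' ?_)
  filter_upwards [eventually_rho_pos_and hρ hc] with δ hδ
  rw [rescaledCorrelator_smul_smul hc, rescaledCorrelator_apply, ← mul_assoc, ← mul_pow,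
    div_mul_cancel₀ _ hδ.1.ne']

/-- `Φ(1) = 1`. [folklore] -/
theorem ratio_one (hnd : IsNondegenerateTwoPoint S) :
    Real.sqrt (S 2 ![0, EuclideanSpace.single 0 1] /
      S 2 ![0, (1:ℝ)⁻¹ • EuclideanSpace.single 0 1]) = 1 := by
  have hA : 0 < S 2 ![0, EuclideanSpace.single 0 1] := by
    refine hnd _ ?_
    have := axis_mem_nonCoincident (t := 1) one_ne_zero
    simpa using this
  rw [inv_one, one_smul, div_self hA.ne', Real.sqrt_one]

/-- `Φ(c) > 0` for `c > 0`. [folklore] -/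
theorem ratio_pos (hnd : IsNondegenerateTwoPoint S) {c : ℝ} (hc : 0 < c) :
    0 < Real.sqrt (S 2 ![0, EuclideanSpace.single 0 1] /
      S 2 ![0, c⁻¹ • EuclideanSpace.single 0 1]) := by
  apply Real.sqrt_pos.2
  refine div_pos (hnd _ ?_) (hnd _ (axis_mem_nonCoincident (inv_ne_zero hc.ne')))
  have := axis_mem_nonCoincident (t := 1) one_ne_zero
  simpa using this

/-- **`Φ` is multiplicative**: `Φ(ab) = Φ(a)Φ(b)` (`ρ(abδ)/ρ(δ) = [ρ(a·bδ)/ρ(bδ)]·[ρ(bδ)/ρ(δ)]`).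
[folklore] -/
theorem ratio_mul (hρ : ∀ δ ∈ Set.Ioc (0:ℝ) 1, 0 < ρ δ)
    (hlim : HasPointwiseScalingLimit (criticalCorr 3) ρ S) (hnd : IsNondegenerateTwoPoint S)
    {a b : ℝ} (ha : 0 < a) (hb : 0 < b) :
    Real.sqrt (S 2 ![0, EuclideanSpace.single 0 1] /
        S 2 ![0, (a * b)⁻¹ • EuclideanSpace.single 0 1]) =
      Real.sqrt (S 2 ![0, EuclideanSpace.single 0 1] /
          S 2 ![0, a⁻¹ • EuclideanSpace.single 0 1]) *
        Real.sqrt (S 2 ![0, EuclideanSpace.single 0 1] /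
          S 2 ![0, b⁻¹ • EuclideanSpace.single 0 1]) := by
  have hab := tendsto_rho_ratio hρ hlim hnd (mul_pos ha hb)
  have ha' := (tendsto_rho_ratio hρ hlim hnd ha).comp (tendsto_const_mul_nhdsGT hb)
  have hb' := tendsto_rho_ratio hρ hlim hnd hb
  refine tendsto_nhds_unique hab ((ha'.mul hb').congr' ?_)
  filter_upwards [eventually_rho_pos_and hρ hb] with δ hδ
  simp only [Function.comp_apply]
  rw [mul_assoc, div_mul_div_cancel₀ hδ.2.ne']

/-- **`Φ ≤ 1` beyond the MMS factor**: `Φ(c) ≤ 1` for `c > 3` (Messager–Miracle-Solé in the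
limit: `S₂(0, ce₀) ≤ S₂(0, e₀)` once `3·1 < c`, and `S₂(0,ce₀) = Φ(c)²S₂(0,e₀)`).
[cite: MessagerMiracleSoleJSP1977, Theorem (monotonicity)] -/
theorem ratio_le_one_of_three_lt (hρ : ∀ δ ∈ Set.Ioc (0:ℝ) 1, 0 < ρ δ)
    (hlim : HasPointwiseScalingLimit (criticalCorr 3) ρ S) (hnd : IsNondegenerateTwoPoint S)
    {c : ℝ} (hc : 3 < c) :
    Real.sqrt (S 2 ![0, EuclideanSpace.single 0 1] /
      S 2 ![0, c⁻¹ • EuclideanSpace.single 0 1]) ≤ 1 := by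
  have hc0 : 0 < c := by linarith
  set e : EuclideanSpace ℝ (Fin 3) := EuclideanSpace.single 0 1 with he
  have hz₀m : (![0, e] : Fin 2 → EuclideanSpace ℝ (Fin 3)) ∈ NonCoincident 3 2 := by
    have := axis_mem_nonCoincident (t := 1) one_ne_zero
    simpa [he] using this
  have hczm : (![0, c • e] : Fin 2 → EuclideanSpace ℝ (Fin 3)) ∈ NonCoincident 3 2 :=
    axis_mem_nonCoincident hc0.ne'
  have hA : 0 < S 2 ![0, e] := hnd _ hz₀m
  -- MMS in the limit
  have hmms : S 2 ![0, c • e] ≤ S 2 ![0, e] := by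
    refine hlim.two_le_two_of_mul_norm_lt (by norm_num) hz₀m hczm ?_
    have hn : ‖WithLp.ofLp e‖ = 1 := by
      rw [he, PiLp.ofLp_single, Pi.norm_single, norm_one]
    simp only [Matrix.cons_val_zero, Matrix.cons_val_one, Matrix.cons_val_fin_one, WithLp.ofLp_zero,
      zero_sub, norm_neg, WithLp.ofLp_smul, norm_smul, Real.norm_eq_abs, abs_of_pos hc0, hn]
    push_cast
    linarith
  -- `S₂(0, ce₀) = Φ(c)² S₂(0, e₀)`
  have hsc := smul_eq_ratio_pow_mul hρ hlim hnd hc0 hz₀m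
  have hcfg : (fun i => c • (![0, e] : Fin 2 → EuclideanSpace ℝ (Fin 3)) i) = ![0, c • e] := by
    funext i; fin_cases i <;> simp
  rw [hcfg] at hsc
  rw [hsc] at hmms
  have hsq : Real.sqrt (S 2 ![0, e] / S 2 ![0, c⁻¹ • e]) ^ 2 ≤ 1 := by
    by_contra h
    push Not at h
    have := mul_lt_mul_of_pos_right h hA
    rw [one_mul] at this
    linarith
  exact (pow_le_one_iff_of_nonneg (Real.sqrt_nonneg _) two_ne_zero).1 hsq

/-- **`Φ ≤ 1` on `(1, ∞)`**: multiplicativity upgrades the previous lemma (`Φ(c)^m = Φ(c^m) ≤ 1`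
for `c^m > 3`). [folklore] -/
theorem ratio_le_one_of_one_lt (hρ : ∀ δ ∈ Set.Ioc (0:ℝ) 1, 0 < ρ δ)
    (hlim : HasPointwiseScalingLimit (criticalCorr 3) ρ S) (hnd : IsNondegenerateTwoPoint S)
    {c : ℝ} (hc : 1 < c) :
    Real.sqrt (S 2 ![0, EuclideanSpace.single 0 1] /
      S 2 ![0, c⁻¹ • EuclideanSpace.single 0 1]) ≤ 1 := by
  have hc0 : 0 < c := by linarith
  obtain ⟨m, hm⟩ := pow_unbounded_of_one_lt (3:ℝ) hc
  -- `Φ(c^m) = Φ(c)^m`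
  have hpow : ∀ k : ℕ, Real.sqrt (S 2 ![0, EuclideanSpace.single 0 1] /
      S 2 ![0, (c ^ k)⁻¹ • EuclideanSpace.single 0 1]) =
        Real.sqrt (S 2 ![0, EuclideanSpace.single 0 1] /
          S 2 ![0, c⁻¹ • EuclideanSpace.single 0 1]) ^ k := by
    intro k
    induction k with
    | zero => rw [pow_zero, pow_zero]; exact ratio_one hnd
    | succ k ih => rw [pow_succ, ratio_mul hρ hlim hnd (pow_pos hc0 k) hc0, ih, pow_succ]
  have hm0 : m ≠ 0 := by rintro rfl; norm_num at hm
  have h := ratio_le_one_of_three_lt hρ hlim hnd hm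
  rw [hpow m] at h
  exact (pow_le_one_iff_of_nonneg (Real.sqrt_nonneg _) hm0).1 h

/-- **`Φ` is a power law**: `Φ(c) = c^{-Δ'}` for some `Δ' ≥ 0` and all `c > 0` — a positive,
multiplicative function on `(0,∞)` which is `≤ 1` on `(1,∞)` is a power (monotone additive maps
`ℝ → ℝ` are measurable, hence continuous, hence linear). [folklore] -/
theorem exists_ratio_eq_rpow (hρ : ∀ δ ∈ Set.Ioc (0:ℝ) 1, 0 < ρ δ)
    (hlim : HasPointwiseScalingLimit (criticalCorr 3) ρ S) (hnd : IsNondegenerateTwoPoint S) :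
    ∃ Δ' : ℝ, 0 ≤ Δ' ∧ ∀ c : ℝ, 0 < c →
      Real.sqrt (S 2 ![0, EuclideanSpace.single 0 1] /
        S 2 ![0, c⁻¹ • EuclideanSpace.single 0 1]) = c ^ (-Δ') := by
  -- the ratio as a function of `c`
  set Φ : ℝ → ℝ := fun c => Real.sqrt (S 2 ![0, EuclideanSpace.single 0 1] /
    S 2 ![0, c⁻¹ • EuclideanSpace.single 0 1]) with hΦ
  have hΦpos : ∀ c, 0 < c → 0 < Φ c := fun c hc => ratio_pos hnd hc
  have hΦmul : ∀ a b, 0 < a → 0 < b → Φ (a * b) = Φ a * Φ b := fun a b ha hb =>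
    ratio_mul hρ hlim hnd ha hb
  have hΦle : ∀ c, 1 < c → Φ c ≤ 1 := fun c hc => ratio_le_one_of_one_lt hρ hlim hnd hc
  have hΦone : Φ 1 = 1 := by
    have := ratio_one (S := S) hnd
    simpa only [hΦ, inv_one] using this
  -- the additive function `f(u) = log Φ(e^u)`
  set f : ℝ →+ ℝ := AddMonoidHom.mk' (fun u => Real.log (Φ (Real.exp u))) (by
    intro u v
    change Real.log (Φ (Real.exp (u + v))) = Real.log (Φ (Real.exp u)) + Real.log (Φ (Real.exp v))
    rw [Real.exp_add, hΦmul _ _ (Real.exp_pos u) (Real.exp_pos v),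
      Real.log_mul (hΦpos _ (Real.exp_pos u)).ne' (hΦpos _ (Real.exp_pos v)).ne']) with hf
  have hf_apply : ∀ u, f u = Real.log (Φ (Real.exp u)) := fun u => rfl
  have hf_nonpos : ∀ u, 0 ≤ u → f u ≤ 0 := by
    intro u hu
    rw [hf_apply]
    rcases hu.lt_or_eq with hu | hu
    · have h1 : 1 < Real.exp u := by simpa using hu
      exact Real.log_nonpos (hΦpos _ (Real.exp_pos u)).le (hΦle _ h1)
    · rw [← hu, Real.exp_zero, hΦone, Real.log_one]
  have hanti : Antitone f := by
    intro u v huv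
    have : f v = f u + f (v - u) := by rw [← map_add]; congr 1; ring
    rw [this]
    linarith [hf_nonpos (v - u) (by linarith)]
  have hcont : Continuous f := MeasureTheory.Measure.AddMonoidHom.continuous_of_measurable f hanti.measurable
  have hlin : ∀ u, f u = u * f 1 := by
    intro u
    have := map_real_smul f hcont u 1
    rwa [smul_eq_mul, mul_one, smul_eq_mul] at this
  refine ⟨-f 1, by linarith [hf_nonpos 1 zero_le_one], fun c hc => ?_⟩
  have h1 : Φ c = Real.exp (f (Real.log c)) := by
    rw [hf_apply, Real.exp_log hc, Real.exp_log (hΦpos c hc)]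
  show Φ c = c ^ (-(-f 1))
  rw [h1, hlin, neg_neg, Real.rpow_def_of_pos hc]

/-- **Scale covariance is automatic on non-coincident configurations**: for any non-degenerate
pointwise scaling limit of the critical correlators on `ℤ³` there is `Δ' ≥ 0` with
`S_n(c·x) = c^{-nΔ'} S_n(x)` for all `n`, `c > 0` and non-coincident `x`. [folklore] -/
theorem exists_scaleCovariant_on_nonCoincident (hρ : ∀ δ ∈ Set.Ioc (0:ℝ) 1, 0 < ρ δ)
    (hlim : HasPointwiseScalingLimit (criticalCorr 3) ρ S) (hnd : IsNondegenerateTwoPoint S) :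
    ∃ Δ' : ℝ, 0 ≤ Δ' ∧ ∀ (n : ℕ) (c : ℝ), 0 < c → ∀ x ∈ NonCoincident 3 n,
      S n (fun i => c • x i) = c ^ (-(n : ℝ) * Δ') * S n x := by
  obtain ⟨Δ', hΔ', hΦ⟩ := exists_ratio_eq_rpow hρ hlim hnd
  refine ⟨Δ', hΔ', fun n c hc x hx => ?_⟩
  rw [smul_eq_ratio_pow_mul hρ hlim hnd hc hx, hΦ c hc, ← Real.rpow_natCast,
    ← Real.rpow_mul hc.le]
  congr 2
  ring

end Summit.CriticalPhenomena.Ising3DConformalLimit.MoebiusLimitExistsNegative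

end
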